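import Summits.BirchSwinnertonDyer.BirchSwinnertonDyer.Theses.ByReductionTypeAtTwo
import Summits.BirchSwinnertonDyer.BirchSwinnertonDyer.Theorems.ByReductionTypeAtTwoRankOneAtTwoOneDoorLawDefs
import Summits.BirchSwinnertonDyer.BirchSwinnertonDyer.Theorems.ByReductionTypeAtTwoRankOneAtTwoOneDoorLawCDefs
import Summits.BirchSwinnertonDyer.BirchSwinnertonDyer.Theorems.ByReductionTypeAtTwoRankOneAtTwoOneDoorLawBottomDefs
import Summits.BirchSwinnertonDyer.BirchSwinnertonDyer.Theorems.ByReductionTypeAtTwoRankOneAtTwoBigImageOddLocalOneDoorAnalyticAssemblyC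
import Summits.BirchSwinnertonDyer.BirchSwinnertonDyer.Theorems.ByReductionTypeAtTwoRankOneAtTwoBigImageOddLocalOneDoorFullCPrimary
import Summits.BirchSwinnertonDyer.BirchSwinnertonDyer.Theorems.ByReductionTypeAtTwoRankOneAtTwoBigImageOddLocalOneDoorHalvesAssembly
import Summits.BirchSwinnertonDyer.BirchSwinnertonDyer.Theorems.ByReductionTypeAtTwoRankOneAtTwoBigImageOddLocalOneDoorGlue
import Summits.BirchSwinnertonDyer.BirchSwinnertonDyer.Theorems.ByReductionTypeAtTwoRankOneAtTwoBigImageOddLocalOneDoorAnalyticGlue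
import Summits.BirchSwinnertonDyer.BirchSwinnertonDyer.Theorems.ByReductionTypeAtTwoRankOneAtTwoBigImageOddLocalOneDoorTwinValue
import Summits.BirchSwinnertonDyer.BirchSwinnertonDyer.Theorems.ByReductionTypeAtTwoRankOneAtTwoBigImageOddLocalOneDoorManin
import Summits.BirchSwinnertonDyer.BirchSwinnertonDyer.Theorems.ByReductionTypeAtTwoRankOneAtTwoBigImageOddLocalOneDoorBottomFrame
import Summits.BirchSwinnertonDyer.BirchSwinnertonDyer.Theorems.ByReductionTypeAtTwoRankOneAtTwoBigImageOddLocalOneDoorBottomAssemblyNegFull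
import Summits.BirchSwinnertonDyer.BirchSwinnertonDyer.Theorems.ByReductionTypeAtTwoRankOneAtTwoBigImageOddLocalOneDoorBottomFirstLayerNeg
import Summits.BirchSwinnertonDyer.BirchSwinnertonDyer.Theorems.ByReductionTypeAtTwoRankOneAtTwoBigImageOddLocalOneDoorBottomFirstLayerPos
import Summits.BirchSwinnertonDyer.BirchSwinnertonDyer.Theorems.ByReductionTypeAtTwoRankOneAtTwoBigImageOddLocalOneDoorBottomPosAssembly
import Summits.BirchSwinnertonDyer.BirchSwinnertonDyer.Theorems.ByReductionTypeAtTwoRankOneAtTwoBigImageOddLocalOneDoorBottomFrameCTFree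
import Summits.BirchSwinnertonDyer.BirchSwinnertonDyer.Theorems.GenusKolyvaginAtTwoKolyvaginRelationAtTwo
import Literature.NumberTheory.EllipticCurves.NonvanishingTwistsWaldspurgerOfHoffsteinLuo
import Literature.NumberTheory.EllipticCurves.NonvanishingTwistsProofs
import Literature.NumberTheory.EllipticCurves.BSDRootNumberModularityOnlyProofs
import HarnessLib

/-!
# LINE v8.13 `one_door_analytic` for the crux `RankOneAtTwoBigImageOddLocal` (stmt-BirchSwinnertonDyer-23715)
# — planner `bsd-f1-sign2-an` g11 (LENS analytic / Waldspurger–Gross–Zagier), MEMO-an v1.21 AN-28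

Registered ALONGSIDE the lead's line of record `Lines/one_door_law.lean` (v7.2; never touched by this file).  Same door
(`P2.bsdp_two_iff_of_heegner_rankOne`), same carriers (`DoorAdmissible`, `transpCount` = `t`, `identCount` = `s`,
`HasTwoDivisibilityUpToTorsion` = `m`; all the TREE's, `Theorems/ByReductionTypeAtTwoRankOneAtTwoOneDoorLawDefs.lean`,
p610929), ONE change of lever:

**choose the door field by Waldspurger / Hoffstein–Luo NON-VANISHING, not by Selmer vanishing, and let
`s_d := ord₂ #Ш(E^{(d)})[2^∞]` float.**

* v7.2 picks a `Sel₂(E^{(d)}) = 0` door (Mazur–Rubin, `DoorSupplyAtTwo`) and must then prove `L(E^{(d)},1) ≠ 0` — the rank-`0`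
  `2`-CONVERSE for non-CM curves, open in print (the lead's 07:39Z reshaping names it as an OPEN analytic stub of
  `DoorTwistValueAtTwo`).
* v8 picks `d` with `L(E^{(d)},1) ≠ 0` DIRECTLY from the tree's named fact `HoffsteinLuo1997_exists_twist_L_one_ne_zero`
  (`d ≡ 1 (8)`, square-free, `(d/ℓ) = 1` at the odd bad `ℓ`; `d < 0` is forced by the sign `w(E) = −1`, tree theorem
  `exists_neg_fundamental_twist_ne_zero_of_hoffsteinLuo`), and such a `d` IS door-admissible — PROVED below
  (`doorSupplyAnalyticAtTwo_of_pubHL`).  The price is that `Ш(E^{(d)})[2]` is no longer known to vanish; but `s_d` enters the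
  index law and the value law with the SAME sign and CANCELS in the door formula (PROVED below, `doorGlueAn`):
  index `2m + [Δ<0] = s_E + s_d + t + 2s`, value `v₂ q_d = v₂ ∏c_ℓ(E) + t + 2s + s_d`, door
  `ord₂(8 I² t_W² /(n k² t_K² c² w² q_d |u| c_W)) = 1 + 2m − [Δ>0] − v₂ q_d = s_E`.
  The value law with `s_d` is exactly rank-`0` `BSD₂` of the minimal twist model — i.e. the route's OWN four
  `…RankZeroAtTwo` cruxes at `Wd` (stub `stub_rankZeroAtTwo` = those items BY NAME) plus kernel twist arithmetic
  (`stub_twinArith`: `T(E^{(d)})` odd, `c_q(E^{(d)}) = 1 + #roots` at the `I₀*` door primes, `c_ℓ(E^{(d)}) = c_ℓ(E)` at `ℓ ∣ N`).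

Net effect on the cone of 23715: the rank-`0` `2`-converse and the Mazur–Rubin supply DROP OUT; what is left open is
`DoorIndexLawFullAtTwo` (the lens' conjecture: Kolyvagin exactness at `2` in `E`-side currency, census ENGINE L j300076
P27.1 = 597/597 certified rows, 166 of them with `s_d = 2`), `S_manin` (odd constant; open only for `4 ∣ N`), the route's
rank-`0` cruxes (which `closes` consumes anyway) and PRINT (`S_pub`, `S_pubHL`).  Mirror remark: route GenusKolyvaginAtTwo reads
rank-`0` `BSD₂(E)` from exactness over `K` plus `BSD₂` of a rank-`1` twin (`ExactDescentAtTwoOfFourFacts`, PROVED); this line is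
the same descent with the roles of the pair swapped.  BSD is not proved by any of this.

v8.1 (08:2xZ, after the lead's 08:10Z note): the index law is now the PURE IDENTITY (no finiteness conjuncts) = the RHS of the lead's
`bsdp_two_iff_doorLawFull_at` (p615533), and its stub is guarded `S_pub → DoorIndexLawFullAtTwo`.

Stubs (6, sorried): `stub_pub`, `stub_pubHL` (PRINT), `stub_doorIndexFull` (CONJECTURE, load-bearing), `stub_rankZeroAtTwo`
(route items by name), `stub_twinArith` (kernel, theorem-grade), `stub_manin`.  PROVED here: the supply
(`doorSupplyAnalyticAtTwo_of_pubHL`), the reduction-type exhaustion (`rankZeroTwin_of_rankZeroAtTwo`), the glue (`doorGlueAn`,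
the lead's `stub_doorGlue` p611607 with `s_d` carried), the composition `comp`, and `RankOneAtTwoBigImageOddLocal_of` BY NAME.
Disproof used: none on file for this crux (no `Disproof.lean`, 2026-08-28T08:00Z).

v8.2 (LEAD bsd-line-fkl-p1 g6, 2026-08-28T08:5xZ — LINE OF RECORD, supersedes `Lines/one_door_law.lean` v7.4): the statements
`S_pubHL`, `DoorSupplyAnalyticAtTwo`, `@[conjecture] DoorIndexLawFullAtTwo`, `DoorTwinValueAtTwo`, `S_rankZeroTwin`,
`DoorTwinValueAtTwoOfRankZero`, `S_doorGlueAn` are now the TREE's (`Theorems/…OneDoorLawDefs.lean` APPEND #3, p617185; bodies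
v8.1 verbatim) and only `open`ed here; §1 (supply) and §3 (glue) are the tree theorems `doorSupplyAnalyticAtTwo_of_pubHL` /
`doorGlueAn` (`Theorems/…OneDoorAnalyticGlue.lean`); the kernel stub `stub_twinArith` is DISCHARGED by the
width seat's tree theorem `doorTwinValueAtTwo_of_rankZeroTwin` (p616880, over `doorTwistTamagawaAtTwo` p616165) with modularity out
of `S_pub` (also filed by name as `RankOneAtTwoOneDoor.stub_twinArith` in `Theorems/…OneDoorAnalyticAssembly.lean`).  Sorries 6 → 5: `stub_pub`, `stub_pubHL` (PRINT), `stub_doorIndexFull` (AN-28, CONJECTURE,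
load-bearing), `stub_rankZeroAtTwo` (the route's own four rank-`0` items), `stub_manin` (open only for `4 ∣ N`).
v8.3 (LEAD g6, 2026-08-28T09:1xZ): the MANIN stub SPLIT — `stub_manin` is DERIVED (tree theorem `RankOneAtTwoOneDoor.s_manin_of`,
`Theorems/…OneDoorManin.lean`: optimal datum + Abbes–Ullmo / Česnavičius + ODD Néron multiplier from `E[2]` irreducible) from
`stub_maninPub : S_maninPub` (PRINT) and `stub_maninAdditive : ManinOddAdditiveLevelAtTwo` (OPEN only at additive level
`4 ∣ N_E`; tree `@[conjecture]`, `…OneDoorLawDefs.lean` APPEND #4).  Stubs: 6 = `stub_pub` · `stub_pubHL` · `stub_maninPub`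
(PRINT) · `stub_doorIndexFull` (AN-28, CONJECTURE, load-bearing) · `stub_rankZeroAtTwo` (route items) · `stub_maninAdditive`
(OPEN at `4 ∣ N`).  Every other statement of the line is a kernel theorem.
v8.4 (LEAD g7, 2026-08-28T09:5xZ): the MANIN-FREE reshape — the parametrisation constant is NOT an input of `BSD₂`.  The tree
door carries `c²` and needs only `c ≠ 0` (a theorem); v8.3 fixed an odd-`c` datum merely to set `v₂ c = 0`.  The load-bearing law
is now stated for EVERY datum with the correction `2·v₂(c)` carried (`@[conjecture] RankOneAtTwoOneDoor.DoorIndexLawFullCAtTwo`,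
AN-28c, `Theorems/…OneDoorLawCDefs.lean` p621906; = AN-28 on odd-`c` data, so every ENGINE-L row of AN-28 is a row of AN-28c;
still LOSSLESS: per-datum kernel iff `bsdp_two_iff_doorLawFullC_at`, `Theorems/…OneDoorFullC.lean` p621746), the glue takes ANY
datum, and a datum exists by modularity alone (`nonempty_modularParametrizationData_iff_exists_isNewformOf_unconditional`):
`doorGlueAnC` / `rankOneAtTwoBigImageOddLocal_of_oneDoorAnalyticC` (`Theorems/…OneDoorAnalyticAssemblyC.lean`).  REMOVED from
the skeleton (not inputs): `stub_maninPub` (Abbes–Ullmo, Česnavičius), `stub_maninAdditive` (`@[conjecture]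
ManinOddAdditiveLevelAtTwo`, the `2`-primary Manin conjecture at `4 ∣ N`), the derived `stub_manin`, and the discharged
`stub_twinArith` (its content is inside `doorGlueAnC` via `S_rankZeroTwin` + `doorTwistTamagawaAtTwo`).  Not adopted: REF2 v21-add1's
CNS split of the Manin stub — vacuous on this slice by Calegari–Emerton 2009 Thm. 1 (odd modular degree ⇒ even analytic rank).
Stubs: 4 = `stub_pub` · `stub_pubHL` (PRINT) · `stub_doorIndexFullC` (AN-28c, CONJECTURE, LOAD-BEARING) · `stub_rankZeroAtTwo`
(the route's OWN four rank-`0` items BY NAME).  BSD is not proved by any of this.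
v8.5 (LEAD g7 + width seat fkl-p2 g7, 2026-08-28T10:0xZ): PRINT made PRIMARY.  The width seat's `…OneDoorFullCPrimary.lean`
(`bsdp_two_iff_doorLawFullC_at_of_rank`, `doorGlueAnC_of_primary`, `rankOneAtTwoBigImageOddLocal_of_oneDoorAnalyticC_primary4`, over
its primary door p620211 and its rank-one GZK from four facts p621008) runs the Manin-free glue on the FOUR PRIMARY named facts
{`gross_zagier`, `kolyvagin`, `exists_isNewformOf`, `HoffsteinLuo1997_exists_twist_L_one_ne_zero`} — the composite
`rank_eq_analyticRank_of_analyticRank_le_one` (GZK over `ℚ`, bundling Murty–Murty for rank `0`), the derivable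
`hasEntireLFunction_rat` and the tree theorem `heegnerPointComplex_mem_range_map` leave the PRINT stub.  Stubs: 3 = `stub_pub4`
(PRINT ×4, the local conjunction `S_pub4` of the four tree facts) · `stub_doorIndexFullC : S_pub4 → DoorIndexLawFullCAtTwo` (AN-28c,
CONJECTURE, LOAD-BEARING) · `stub_rankZeroAtTwo` (route items).  Cone of 23715 = four primary printed theorems · ONE conjecture ·
the route's own rank-`0` cruxes.  BSD is not proved by any of this.
v8.6 (LEAD g8, 2026-08-28T10:5xZ): the HALVES RESHAPE.  The one open conjecture AN-28c is an IDENTITY between the index side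
`2m + [Δ_W<0]` and the `Ш` side `s_E + s_d + t + 2s + 2·v₂(c)`; by the width seat fkl-p2 g8's `doorValuationC_at`
(`Theorems/…OneDoorValuation.lean`: `ord₂ #Ш_an(W) = 2m + [Δ_W<0] − s_d − t − 2s − 2·v₂(c)` modulo print and `BSD₂` of the twin) each
INEQUALITY is one half of `BSD₂(W)` in Miller's currency.  The skeleton now carries the two halves as separate load-bearing stubs —
`@[conjecture] DoorIndexLawUpperCAtTwo` (AN-28c-U, `Ш`-side `≤` index-side: the EULER-SYSTEM half = Kolyvagin's bound with the exact power
of `2`, printed for odd `p` only — Kolyvagin 1990 / Gross 1991 / Cha 2005 Thm. 3 «ℓ odd») and `@[conjecture] DoorIndexLawLowerCAtTwo`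
(AN-28c-L, index-side `≤` `Ш`-side: the CONVERSE half = Kolyvagin's conjecture / `p`-converse / main-conjecture direction, W. Zhang 2014
`p ≥ 5`, JSW 2017 `p` odd), both tree statements (`…OneDoorLawCDefs.lean` APPEND #6, p626076) — and the split is LOSSLESS modulo print
(`doorIndexLawFullCAtTwo_iff_halves`, `Theorems/…OneDoorHalvesAssembly.lean`: the exponent exists and is unique at every door datum by
Gross–Zagier + Kolyvagin, `exists_unique_exponent_at_door`).  The halves are the E-side images of route GenusKolyvaginAtTwo's K-side stubs
`stub_upperBoundAtTwo` / `stub_lowerBoundAtTwo` of `KolyvaginExactAtTwo` (stmt-22137).  Stubs: 4 = `stub_pub4` (PRINT ×4) ·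
`stub_doorUpperC : S_pub4 → DoorIndexLawUpperCAtTwo` (AN-28c-U, CONJECTURE) · `stub_doorLowerC : S_pub4 → DoorIndexLawLowerCAtTwo`
(AN-28c-L, CONJECTURE) · `stub_rankZeroAtTwo` (route items); composition `rankOneAtTwoBigImageOddLocal_of_oneDoorAnalyticC_halves`.
Cone of 23715 = four primary printed theorems · TWO half-conjectures (jointly = `BSD₂` of the slice in Heegner-index currency) · the
route's own rank-`0` cruxes.  BSD is not proved by any of this.
v8.7 (LEAD g11, 2026-08-28T14:0xZ): the BOTTOM-RUNG reshape of the Euler-system half.  `stub_doorUpperC` (AN-28c-U) is SPLIT, losslessly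
(`doorIndexLawUpperCAtTwo_iff_bottomNeg_and_offBottomNeg`, `Theorems/…OneDoorLawBottomDefs.lean` p638178), into
`stub_doorUpperBottomNeg : S_pub4 → DoorIndexLawUpperCAtTwoBottomNeg` — U₀⁻, the corner `Δ_W < 0`, MINIMAL door (`t = 1`, `s = 0`), odd
constant, `m = 0`: `y_K ∉ 2E(K) ⟹ Ш(W)[2] = Ш(Wd)[2] = 0`, THEOREM-GRADE on paper by Kolyvagin's FIRST `2`-descent run over `ℚ` (`E` and
`E^K` share `E[2]`; their Selmer groups live in one `H¹(ℚ, E[2])` with local conditions equal off the one error place `q₀` and one line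
each at `q₀`), whose abstract engine — Gross 1991 §10 at `p = 2`, eigenspace-free — is the KERNEL theorem file
`Theorems/…OneDoorFirstDescentAtTwo.lean` (p637958: `res_errorPlace_ne_zero_of_relaxed`, `eq_zero_or_eq_heegner_of_mem_sel`,
`twinSel_eq_bot`); its arithmetic leaves are Gross's Prop. 6.2 (1)(2) at `2` for the FIRST layer (the `M = 2` face of route
GenusKolyvaginAtTwo's item 24880; no structure theorem 24882, no `±`-eigenspaces), Poitou–Tate (tree theorem
`poitouTate_sum_localTatePairing_eq_zero_holds`), local Tate duality for `E[2]` over `ℚ_ℓ`, Čebotarev at `M = 2` (tree theorem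
`equivariantChebotarevAtTwoR_proof`, item 27280), Mazur–Rubin 2010 Lemmas 2.2 (i)/2.10, Cassels–Tate parity (tree `CasselsTateParity`) and
Gross–Zagier–Kolyvagin ranks (PRINT) — and `stub_doorUpperOffBottomNeg : S_pub4 → DoorIndexLawUpperCAtTwoOffBottomNeg`, the honest
CONJECTURE-GRADE residue of U (`Δ_W > 0` = gk2 residual 24883; non-minimal doors = Heegner `2`-divisibility from genus excess; `m ≥ 1` =
higher layers, item 24882; even constants).  Stubs: 5 = `stub_pub4` (PRINT ×4) · `stub_doorUpperBottomNeg` (U₀⁻, THEOREM-GRADE) ·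
`stub_doorUpperOffBottomNeg` (CONJECTURE) · `stub_doorLowerC` (AN-28c-L, CONJECTURE) · `stub_rankZeroAtTwo` (route items); composition
`comp` via `doorIndexLawUpperCAtTwo_of_bottomNeg_of_offBottomNeg` then v8.6's `rankOneAtTwoBigImageOddLocal_of_oneDoorAnalyticC_halves`.
Disproof used: none on file (no `Disproof.lean` / `Negative/` for this crux, 2026-08-28T14:00Z).  BSD is not proved by any of this.
v8.8 (LEAD g11, 2026-08-28T14:5xZ): the bottom rung made SIGN-FREE.  The engine p637958 has an ABSTRACT error place; MEMO-es §18.11 (-es g9, U₀⁺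
`HeegnerCornerPosDiscAtTwo`) runs the same first `2`-descent at `Δ_W > 0` with the error place `∞` and REGULAR Kolyvagin primes (`Frob_ℓ` a transposition on
`E[2]`, inert in `K`; at `M = 2` the Euler-system congruences hold for them), where Gross's `Frob_ℓ = Frob_∞` primes are vacuous.  So the two corners are ONE
statement `DoorIndexLawUpperCAtTwoBottom` (`Theorems/…OneDoorLawBottomDefs.lean` APPEND #7b, p639188): MINIMAL door `t + 2s = [Δ_W < 0]` (one error place:
the transposition prime `q₀` when `Δ_W < 0`, the real place when `Δ_W > 0`), odd constant, `m = 0` ⟹ `Ш(W)[2] = Ш(Wd)[2] = 0`; THEOREM-GRADE on paper for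
both signs (all inputs in print or elementary: Gross 3.7/§4/5.4/6.2 verbatim at `M = 2` with regular primes, -es (I5) = 5 lines of algebra + Hasse, reciprocity,
Čebotarev, one-place Poitou–Tate / Cassels–Tate parity, Kramer 1981 Prop. 6 at `∞`, MR10 Lemmas 2.2/2.9/2.10).  Stubs: 5 = `stub_pub4` (PRINT ×4) ·
`stub_doorUpperBottom : S_pub4 → DoorIndexLawUpperCAtTwoBottom` (U₀, THEOREM-GRADE, both signs) · `stub_doorUpperOffBottom : S_pub4 →
DoorIndexLawUpperCAtTwoOffBottom` (CONJECTURE: non-minimal doors = Heegner `2`-divisibility from excess error places; `m ≥ 1` = higher layers, item 24882 /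
Kummer entanglement MEMO-es §18; even constants) · `stub_doorLowerC` · `stub_rankZeroAtTwo`; composition via `doorIndexLawUpperCAtTwo_of_bottom_of_offBottom`
(lossless: `doorIndexLawUpperCAtTwo_iff_bottom_and_offBottom`).  BSD is not proved by any of this.
v8.10 (LEAD g12, 2026-08-28T16:3xZ): the bottom rung SPLIT BY SIGN and its `Δ_W < 0` half REDUCED TO THE FIRST-LAYER CLASSES.  Landed since
v8.9 (all `--supports 23715`, kernel-checked): the lead's `…OneDoorKummerRestriction` (res ∘ κ naturality), `…OneDoorBottomHeegnerClass`
(`exists_heegnerClass_at`: the Heegner class `y = κ_ℚ(g)` with `res_K y = κ_K(P)`), Defs APPEND #2 (`plOfNat`, `KolNeg`, `structure FirstLayerClasses`,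
`FirstLayerClassesAtTwoBottomNeg`, `FirstDescentLeavesAtTwoBottomNeg/Pos` + the LOSSLESS split `firstDescentLeavesAtTwoBottom_of_neg_of_pos`),
`…OneDoorBottomAssemblyNeg` (`nonempty_firstDescentInput_neg`), `…OneDoorBottomCrossTransport`, `…OneDoorBottomAssemblyNegFull`
(`firstDescentLeavesAtTwoBottomNeg_of_classes`); the width seat fkl-p2 g10's leaves `…BottomLeavesLines/LeavesRec/NoInflationDefect/Cebotarev/
CebotarevHabitat/CebotarevCopy/Fields` (line₁/line₂/rec₁/rec₂/ceb₁/ceb₂/ceb₂' — Mazur–Rubin 2.2 (i), Poitou–Tate + local duality, Gross 9.1 at 2,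
Čebotarev at M = 2 incl. the twin copy).  So `stub_firstDescentLeaves` (v8.9) ↦ `stub_firstLayerClassesNeg : FirstLayerClassesAtTwoBottomNeg` (the SIX
first-layer fields `c₁, c₂, c_loc ×2, c_loc_iff ×2` at `Δ_W < 0` = Kolyvagin's `d(ℓ)` at `M = 2` descended to `ℚ` on `W`/`Wd` with Gross 6.1 off
`{ℓ, q₀}` and 6.2 (2) = route GenusKolyvaginAtTwo's item 24880 at `(M, m, l) = (1, 1, ℓ)` + descent) + `stub_firstDescentLeavesPos :
FirstDescentLeavesAtTwoBottomPos` (U₀⁺: `Δ_W > 0`, error place `∞`, regular Kolyvagin primes — leaves `line_inr_of_Δ_pos`, `rec_inr` exist, the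
regular-prime Čebotarev supply does not).  Stubs: 7 = `stub_pub4` · `stub_pubCT` (PRINT) · `stub_firstLayerClassesNeg` (24880 face, THEOREM-GRADE
modulo Gross 6.2 at p = 2) · `stub_firstDescentLeavesPos` (U₀⁺, THEOREM-GRADE) · `stub_doorUpperOffBottom` · `stub_doorLowerC` (conjecture-grade) ·
`stub_rankZeroAtTwo`.  Composition: `firstDescentLeavesAtTwoBottom_of_neg_of_pos (firstDescentLeavesAtTwoBottomNeg_of_classes …) …` then as v8.9.

v8.13 (PROPOSAL of the width seat fkl-p2 g12, 2026-08-28T20:xxZ — for the LEAD to adopt; the line of record stays v8.12 until then): CASSELS–TATE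
REMOVED.  The PRINT stub `stub_pubCT : exists_casselsTate_pairing` entered the bottom rung at ONE point — the parity input `heven` of the twin half of the
frame (`twin_selmerTwo_even_at`).  The width seat's `Theorems/…OneDoorBottomFrameCTFree.lean` (`doorIndexLawUpperCAtTwoBottom_of_leaves_ctFree`) replaces
it: the twin engine minus parity gives `#Sel₂(Wd/ℚ) ≤ 2`, the E-side engine `#Sel₂(W/ℚ) = 2`, and route GenusKolyvaginAtTwo's UNCONDITIONAL Mazur–Rubin
Cor. 3.4 (i) DIRECTED at the door's one error place (`GenusKolyTwistLocal.natCard_selmerGroup_twist_directed_of_menu₅_frame`, `T = {q₀}` at `Δ_W < 0`;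
`GenusKolyArch.natCard_selmerGroup_twist_shift_of_menu₅_inl`, `T = {∞}` at `Δ_W > 0`; Poitou–Tate, Tate χ, Lemmas 2.9–2.11 and Kramer's congruence for
the framed identification are tree theorems) excludes `#Sel₂(Wd) = 4`, whence `Sel₂(Wd/ℚ) = 0`.  Stubs: 5 = `stub_pub4` · `stub_pub37` (PRINT) ·
`stub_doorUpperOffBottom` · `stub_doorLowerC` (conjecture-grade) · `stub_rankZeroAtTwo` (route items).  NET: U₀ is PRINT (Gross–Zagier, Kolyvagin,
modularity, Hoffstein–Luo, Gross 3.7 (2)) + kernel glue — Cassels 1962 is no longer in the cone (`doorIndexLawUpperCAtTwoBottom_of_print_ctFree`,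
`Theorems/…OneDoorBottomOfPrintCTFree.lean`).  BSD is not proved by any of this.

v8.12 (LEAD g13, 2026-08-28T19:xxZ): the WHOLE SIGN-FREE BOTTOM RUNG U₀ REDUCED TO PRINT.  `stub_firstDescentLeavesPos : FirstDescentLeavesAtTwoBottomPos`
(U₀⁺, the `Δ_W > 0` corner: error place `∞`, REGULAR Kolyvagin primes) is DERIVED: the width seat fkl-p2 g11's regular-prime Čebotarev supply and
assembly (`Theorems/…OneDoorBottomPosStepB/PosCebotarev/PosAssembly.lean`: `exists_regularKolyvaginPrime_two`, `ceb₁/₂/₂'_pos_rat`,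
`nonempty_firstDescentInput_pos`, `firstDescentLeavesAtTwoBottomPos_of_classes`) reduce it to the `Δ_W > 0` first-layer classes
`FirstLayerClassesAtTwoBottomPos` (`Theorems/…OneDoorFirstDescentPosDefs.lean`, regular primes `KolPos`), and the lead's
`Theorems/…OneDoorBottomFirstLayerPos.lean` (`firstLayerClassesAtTwoBottomPos_of_kolyvaginRelationAtTwo`) derives those from item 24880 exactly as at
`Δ_W < 0`, the `ℚ_ℓ ⟷ K_λ` dictionaries at a regular prime being the lead's TRANSPOSITION-prime dictionary
(`Theorems/…OneDoorBottomTranspositionDictionary.lean`: a Frobenius with `(Δ_min/ℓ) = −1` acts on `E[2]` as a transposition, `E[2] = 𝔽₂P ⊕ 𝔽₂FP`,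
no sign of `Δ`).  Stubs: 6 = `stub_pub4` · `stub_pubCT` · `stub_pub37` (PRINT) · `stub_doorUpperOffBottom` · `stub_doorLowerC` (conjecture-grade) ·
`stub_rankZeroAtTwo` (route items).  NET: the bottom rung U₀ = `DoorIndexLawUpperCAtTwoBottom` of 23715 (Kolyvagin's first `2`-descent over `ℚ` at
EVERY minimal door, both signs of `Δ_W`) is PRINT + kernel glue — Gross–Zagier, Kolyvagin, modularity, Hoffstein–Luo, Cassels–Tate, Gross 3.7 (2);
the line's open content is exactly its two conjecture-grade halves off the bottom rung (`DoorIndexLawUpperCAtTwoOffBottom`, `DoorIndexLawLowerCAtTwo`)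
and the route's rank-0 items.  BSD is not proved by any of this.

v8.11 (LEAD g13, 2026-08-28T1xZ): the `Δ_W < 0` first-layer classes REDUCED TO PRINT.  `stub_firstLayerClassesNeg : FirstLayerClassesAtTwoBottomNeg`
(the six first-layer fields at `Δ_W < 0`) is DERIVED (`Theorems/…OneDoorBottomFirstLayerNeg.lean`,
`firstLayerClassesAtTwoBottomNeg_of_kolyvaginRelationAtTwo`) from route GenusKolyvaginAtTwo's item 24880 `KolyvaginRelationAtTwo` BY NAME, which
is itself a tree theorem modulo ONE print fact (`GenusExact.kolyvaginRelationAtTwo_of_frobeniusCongruence`): the classes are the two descents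
to `ℚ` of Kolyvagin's `c(ℓ) ∈ H¹(K, E[2])` for a conductor-`ℓ` datum compatible with a conductor-`1` datum over the door's frame `(Dt, H.β, ι)`
(`…OneDoorBottomFirstLayerData.lean`: Gross's CM data, Shimura reciprocity at conductor `1`, `c(1) = κ_K(P) = res y`, Gross 5.4 at `2`, `±`
descents); Gross 6.2 (1) over `ℚ` off `{ℓ, q₀}` is McCallum's Lemma 4.3 OVER `K` — at `p = 2` on the odd-Tamagawa slice a THEOREM with no
Heegner-divisor input (`…OneDoorBottomLemma43AtTwo.lean`: unramified class killed by `c_w(E/K) = c_v(E)` odd, Milne *ADT* I.3.8 PROVED in the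
tree) — descended place by place (gk2's one-place transfers; `#E(ℚ_v)[2] = 1` at the `3`-cycle primes of `d_K` from minimality `t = 1`,
`s = 0`); Gross 6.2 (2) direct and across is item 24880 at `(M, m, l) = (1, 1, ℓ)` plus the `ℚ ⟷ K` dictionaries at the inert prime `ℓ`.  So
`stub_firstLayerClassesNeg` ↦ `stub_pub37 : GrossLMS1991.prop37_2_frobeniusCongruence` (PRINT: Gross 1991 Prop. 3.7 (2) = Nekovář 2007 Prop. 4.9,
the Eichler–Shimura congruence for Heegner points; the tree's named fact, XL, no `_holds`).  Stubs: 7 = `stub_pub4` · `stub_pubCT` · `stub_pub37`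
(PRINT) · `stub_firstDescentLeavesPos` (U₀⁺, THEOREM-GRADE) · `stub_doorUpperOffBottom` · `stub_doorLowerC` (conjecture-grade) · `stub_rankZeroAtTwo`
(route items).  NET: the corner U₀⁻ of 23715 (`DoorIndexLawUpperCAtTwoBottomNeg`: Kolyvagin's first `2`-descent over `ℚ` at a minimal `Δ_W < 0`
door) is PRINT + kernel glue — Gross–Zagier, Kolyvagin, modularity, Hoffstein–Luo, Cassels–Tate, Gross 3.7 (2).  BSD is not proved by any of this.

v8.9 (LEAD g12, 2026-08-28T15:1xZ): the bottom rung INSTANTIATED down to its leaves.  The abstract engine now has TWO halves — E-side p637958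
(`Sel₂(E/ℚ) = {0, y}` in `H¹(ℚ, E[2])`) and the twin side IN ITS OWN GROUP `H¹(ℚ, Wd[2])` (`Theorems/…OneDoorFirstDescentPairAtTwo.lean`, p641149:
cross form of Gross 6.2 (2), no `E[2] ≅ E^{(d)}[2]` transport, no Mazur–Rubin Lemma 2.10) — and is INSTANTIATED on the tree's carriers
(`galH1Torsion · 2`, `locAt = selmerLocalKer` / `strictAt = torsionLocalKer` at every place of `ℚ`, `selmerGroup · 2`): the displayed inputs are
the record `FirstDescentInput W Wd` (`Theorems/…OneDoorFirstDescentDefs.lean`: error place `q₀`, Kolyvagin primes, `y = δ(T·y_K)`, first-layer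
classes `c₁ ℓ`, `c₂ ℓ`; fields = Gross 6.2 (1)/(2) direct and across, reciprocity, Čebotarev at `M = 2`, MR10 Lemma 2.2 (i) at `q₀`), and the FRAME
`doorIndexLawUpperCAtTwoBottom_of_leaves` (`Theorems/…OneDoorBottomFrame.lean`: engine ∘ record, then the width seat fkl-p2 g10's Selmer-to-door glue
`doorIndexLawUpperCAtTwoBottom_of_selmerTwo` and parity leaf `twin_selmerTwo_even_at`, Cassels–Tate) proves
`S_pub4 ∧ exists_casselsTate_pairing ∧ FirstDescentLeavesAtTwoBottom ⟹ DoorIndexLawUpperCAtTwoBottom`.  Accordingly `stub_doorUpperBottom` ↦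
`stub_firstDescentLeaves : FirstDescentLeavesAtTwoBottom` («at every bottom-rung datum the input EXISTS»; THEOREM-GRADE, sign-free: `q₀ = v_{q₀}` +
Gross primes at `Δ_W < 0`, `q₀ = ∞` + regular primes at `Δ_W > 0`) + `stub_pubCT : exists_casselsTate_pairing` (PRINT, Cassels 1962 / AEC X.4.14,
the tree's named fact).  Stubs: 6 = `stub_pub4` · `stub_pubCT` (PRINT) · `stub_firstDescentLeaves` (U₀'s input, THEOREM-GRADE; each field a fixed tree
signature: 6.2 at `M = 2` = the first-layer face of item 24880, reciprocity = gk2 `…DualityRat`, Čebotarev = gk2 27280 via p641149's discharge lemmas,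
one-line conditions = local counts) · `stub_doorUpperOffBottom` · `stub_doorLowerC` · `stub_rankZeroAtTwo`.  BSD is not proved by any of this.
-/

noncomputable section

open scoped Classical

namespace Summit.BirchSwinnertonDyer.BirchSwinnertonDyer.Cruxes.RankOneAtTwoBigImageOddLocal.OneDoorAnalytic

open WeierstrassCurve NumberField IsDedekindDomain Rat.HeightOneSpectrum Literature.NumberTheory.EllipticCurves
  Literature.NumberTheory.EllipticCurves.ModularForms
  Literature.NumberTheory.EllipticCurves.KrizLi2019
  Summit.BirchSwinnertonDyer.Rank1Residual.F1Sign2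
  Summit.BirchSwinnertonDyer.Rank1Residual.F1Sign2.TranspositionDoor
  Summit.BirchSwinnertonDyer.Rank1Residual
  Summit.BirchSwinnertonDyer.BirchSwinnertonDyer.Theses.ByReductionTypeAtTwo
  Summit.BirchSwinnertonDyer.BirchSwinnertonDyer.Theorems.RankOneAtTwoOneDoor

set_option autoImplicit false
set_option linter.dupNamespace false

/-! ### §0 The statements: the tree's (`…OneDoorLawDefs.lean` APPEND #3) — `S_pubHL`, `DoorSupplyAnalyticAtTwo`,
`DoorIndexLawFullAtTwo`, `DoorTwinValueAtTwo`, `S_rankZeroTwin`, `DoorTwinValueAtTwoOfRankZero`, `S_doorGlueAn`; plus the one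
local conjunction of ROUTE decls: -/

/-- The route's four rank-`0` cruxes at `2`, BY NAME (items `GoodOrdinaryRankZeroAtTwo`, `SupersingularRankZeroAtTwo`,
`MultiplicativeRankZeroAtTwo`, `AdditiveRankZeroAtTwo` of route ByReductionTypeAtTwo; `closes` consumes them already). -/
def S_rankZeroAtTwo : Prop :=
  GoodOrdinaryRankZeroAtTwo ∧ SupersingularRankZeroAtTwo ∧ MultiplicativeRankZeroAtTwo ∧ AdditiveRankZeroAtTwo

/-- PRINT, PRIMARY (v8.5): the four published theorems the line consumes, BY NAME (tree Literature facts, statements only):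
Gross–Zagier 1986 Thm. I.6.3 (`gross_zagier`), Kolyvagin 1990 Thm. A (`kolyvagin`), modularity as a newform BCDT 2001 Thm. A
(`exists_isNewformOf`), Hoffstein–Luo 1997 (`HoffsteinLuo1997_exists_twist_L_one_ne_zero`). -/
def S_pub4 : Prop :=
  (∀ (N : ℕ) [NeZero N] (W : WeierstrassCurve ℚ) (K : Type) [Field K] [NumberField K], gross_zagier N W K) ∧
    (∀ (N : ℕ) [NeZero N] (W : WeierstrassCurve ℚ) (K : Type) [Field K] [NumberField K], kolyvagin N W K) ∧
    exists_isNewformOf ∧ HoffsteinLuo1997_exists_twist_L_one_ne_zero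

/-! ### §4 The stubs (v8.13: five) -/

/-- S1 PRINT, PRIMARY: Gross–Zagier, Kolyvagin, modularity as a newform, Hoffstein–Luo (four tree named facts, `S_pub4`). -/
theorem stub_pub4 : S_pub4 := by sorry
/-- S1c PRINT (v8.11): Gross 1991 Prop. 3.7 (2) = Nekovář 2007 Prop. 4.9 / 4.13 (ii) — the Eichler–Shimura congruence for Heegner points
`y_n ≡ Frob(λ_m) y_m (mod λ_n)` (the tree's named fact `GrossLMS1991.prop37_2_frobeniusCongruence`, image-free, `p`-free; XL, no `_holds`): the ONE
print input of route GenusKolyvaginAtTwo's item 24880 `KolyvaginRelationAtTwo` (`GenusExact.kolyvaginRelationAtTwo_of_frobeniusCongruence`), through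
which the `Δ_W < 0` first-layer classes `FirstLayerClassesAtTwoBottomNeg` (stub of v8.10) are now DERIVED
(`firstLayerClassesAtTwoBottomNeg_of_kolyvaginRelationAtTwo`, `Theorems/…OneDoorBottomFirstLayerNeg.lean`). -/
theorem stub_pub37 : Literature.NumberTheory.EllipticCurves.GrossLMS1991.prop37_2_frobeniusCongruence := by sorry
/-- S2U⁺ THE RESIDUE of the Euler-system half off the bottom rung (`DoorIndexLawUpperCAtTwoOffBottom`: AN-28c-U at every datum NOT in the corner —
non-minimal doors, `m ≥ 1`, even constants; conjecture-grade; census = AN-28c's), guarded by `S_pub4`. -/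
theorem stub_doorUpperOffBottom : S_pub4 → DoorIndexLawUpperCAtTwoOffBottom := by sorry
/-- S2L THE CONVERSE HALF of the load-bearing law (AN-28c-L `DoorIndexLawLowerCAtTwo`: index-side `≤` `Ш`-side, i.e. the Heegner index is no
more `2`-divisible than `Ш` and the door's local terms account for — Kolyvagin's conjecture / rank-one `2`-converse direction; conjecture;
census = AN-28c's), guarded by the primary PRINT `S_pub4`. -/
theorem stub_doorLowerC : S_pub4 → DoorIndexLawLowerCAtTwo := by sorry
/-- S3 = route ByReductionTypeAtTwo's four `…RankZeroAtTwo` items BY NAME (closes when they close; not a target of this crux). -/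
theorem stub_rankZeroAtTwo : S_rankZeroAtTwo := by sorry

/-! Record of earlier stubs no longer in the skeleton: `stub_pubCT : exists_casselsTate_pairing (K := ℚ)` (v8.9–v8.12, PRINT, the parity of
`dim Sel₂(Wd/ℚ)`; REMOVED in v8.13 — the twin `Sel₂` vanishes by Mazur–Rubin Cor. 3.4 (i) directed at the door's error place,
`doorIndexLawUpperCAtTwoBottom_of_leaves_ctFree`, width seat fkl-p2 g12), `stub_firstDescentLeavesPos : FirstDescentLeavesAtTwoBottomPos` (v8.10–v8.11, U₀⁺; DERIVED in v8.12 from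
`stub_pub37` through item 24880: `firstLayerClassesAtTwoBottomPos_of_kolyvaginRelationAtTwo` + the width seat's `firstDescentLeavesAtTwoBottomPos_of_classes`),
`stub_firstLayerClassesNeg : FirstLayerClassesAtTwoBottomNeg` (v8.10, the `Δ_W < 0`
first-layer classes; DERIVED in v8.11 from `stub_pub37` through item 24880: `firstLayerClassesAtTwoBottomNeg_of_kolyvaginRelationAtTwo
(kolyvaginRelationAtTwo_of_frobeniusCongruence stub_pub37)`), `stub_doorUpperBottom : S_pub4 → DoorIndexLawUpperCAtTwoBottom` (v8.8, U₀ in door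
currency; DERIVED in v8.9 from `stub_pub4` + `stub_pubCT` + `stub_firstDescentLeaves` by the kernel frame `doorIndexLawUpperCAtTwoBottom_of_leaves`),
`stub_doorUpperBottomNeg : S_pub4 → DoorIndexLawUpperCAtTwoBottomNeg` +
`stub_doorUpperOffBottomNeg` (v8.7, the `Δ_W < 0` corner; SUBSUMED by v8.8's sign-free pair — `doorIndexLawUpperCAtTwoBottomNeg_of_bottom`),
`stub_doorUpperC : S_pub4 → DoorIndexLawUpperCAtTwo` (v8.6; SPLIT by v8.7/v8.8, lossless: `doorIndexLawUpperCAtTwo_iff_bottom_and_offBottom`),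
`stub_doorIndexFullC : S_pub4 → DoorIndexLawFullCAtTwo` (v8.5; SPLIT by v8.6 into
`stub_doorUpperC` + `stub_doorLowerC`, lossless: `doorIndexLawFullCAtTwo_iff_halves`), `stub_twinArith` (DISCHARGED, p616880/p616165; inside the glue),
`stub_maninPub` / `stub_maninAdditive` / `stub_manin` (REMOVED by v8.4 — the parametrisation constant floats; `S_manin`,
`S_maninPub`, `ManinOddAdditiveLevelAtTwo` stay in the tree as statements, consumed by nothing on this line), `stub_doorIndexFull`
(AN-28; superseded by AN-28c, `doorIndexLawFullAtTwo_of_doorIndexLawFullCAtTwo`), `stub_pub` / `stub_pubHL` (v8.4 PRINT over the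
composite GZK fact; superseded by the primary `stub_pub4`, v8.5). -/

/-! ### §5 Composition -/

/-- Local name for the route crux (so that `comp` is not itself a second crux-concluding theorem). -/
def Crux : Prop :=
  Summit.BirchSwinnertonDyer.BirchSwinnertonDyer.Theses.ByReductionTypeAtTwo.RankOneAtTwoBigImageOddLocal

/-- Kernel-checked composition (v8.13): the five stub STATEMENTS give the crux (no Cassels–Tate: `doorIndexLawUpperCAtTwoBottom_of_leaves_ctFree`) — BOTH first-layer faces of the bottom rung from Gross 3.7 (2) through item
24880 (`kolyvaginRelationAtTwo_of_frobeniusCongruence`, `firstLayerClassesAtTwoBottomNeg/Pos_of_kolyvaginRelationAtTwo`, the width seat's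
`firstDescentLeavesAtTwoBottomPos_of_classes`), rank-one GZK over `ℚ`, supply, datum existence, twin
arithmetic, glue, and the exponent bookkeeping joining the two halves are tree theorems
(`rankOneAtTwoBigImageOddLocal_of_oneDoorAnalyticC_halves`, `Theorems/…OneDoorHalvesAssembly.lean`, over the width seat fkl-p2 g7's
`rankOneAtTwoBigImageOddLocal_of_oneDoorAnalyticC_primary4`). -/
theorem comp : S_pub4 → Literature.NumberTheory.EllipticCurves.GrossLMS1991.prop37_2_frobeniusCongruence →
    (S_pub4 → DoorIndexLawUpperCAtTwoOffBottom) → (S_pub4 → DoorIndexLawLowerCAtTwo) → S_rankZeroAtTwo → Crux := by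
  rintro h1 h37 hU1 hL ⟨hO, hS, hM, hA⟩
  have hrel := Summit.BirchSwinnertonDyer.BirchSwinnertonDyer.Theorems.GenusExact.kolyvaginRelationAtTwo_of_frobeniusCongruence h37
  have hcl : FirstLayerClassesAtTwoBottomNeg := firstLayerClassesAtTwoBottomNeg_of_kolyvaginRelationAtTwo hrel
  have hclP : FirstLayerClassesAtTwoBottomPos := firstLayerClassesAtTwoBottomPos_of_kolyvaginRelationAtTwo hrel
  have hpos : FirstDescentLeavesAtTwoBottomPos :=
    firstDescentLeavesAtTwoBottomPos_of_classes h1.1 h1.2.1 h1.2.2.1 h1.2.2.2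
      (fun W _ _ _ hCM hsurj hT hc hr K _ _ hK hadm hLt Dt H ι P hP Wd _ _ Cd hWd hmin hodd hm hΔ w₀ hdivK y hymem hyres =>
        hclP W hCM hsurj hT hc hr K hK hadm hLt Dt H ι P hP Wd Cd hWd hmin hodd hm hΔ w₀ hdivK y hymem hyres)
  have hU0 : FirstDescentLeavesAtTwoBottom :=
    firstDescentLeavesAtTwoBottom_of_neg_of_pos (firstDescentLeavesAtTwoBottomNeg_of_classes h1.1 h1.2.1 h1.2.2.1 h1.2.2.2 hcl) hpos
  exact rankOneAtTwoBigImageOddLocal_of_oneDoorAnalyticC_halves h1.1 h1.2.1 h1.2.2.1 h1.2.2.2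
    (doorIndexLawUpperCAtTwo_of_bottom_of_offBottom
      (doorIndexLawUpperCAtTwoBottom_of_leaves_ctFree h1.1 h1.2.1 h1.2.2.1 h1.2.2.2 hU0) (hU1 h1)) (hL h1) ⟨hO, hM, hS, hA⟩

/-- THE SKELETON: the crux BY NAME (type literally the route decl) from exactly the five registered stubs, through `comp`. -/
theorem RankOneAtTwoBigImageOddLocal_of :
    Summit.BirchSwinnertonDyer.BirchSwinnertonDyer.Theses.ByReductionTypeAtTwo.RankOneAtTwoBigImageOddLocal :=
  comp stub_pub4 stub_pub37 stub_doorUpperOffBottom stub_doorLowerC stub_rankZeroAtTwo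

end Summit.BirchSwinnertonDyer.BirchSwinnertonDyer.Cruxes.RankOneAtTwoBigImageOddLocal.OneDoorAnalytic

end
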